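import Mathlib
import Summits.Ventures.PercRepro2.OneTypedEdgeSep
import Summits.Ventures.PercRepro2.A3Inactive

/-!
# The weighted row (W-ROW-23) on `a₃`-inactive instances is the one-edge «MIXED BHK» inequality
(blind cell PercRepro2, night-3 g20, 2026-08-28; `proofs/NIGHT3-CERT.md` §29)

When `a₃` is inactive (never connected to a root) every `σ₃`-term of `K₃` vanishes and, with
`mine-2`'s `Gc_eq_of_a3Inactive` for the contraction and the one-typed-edge expansion
`triSum_singleton_two_K3` (`OneTypedEdgeSep.lean`), the row identity of record is
(`wrow23_slack_of_a3Inactive`)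

  `T₂ − p_e² (1 − p_e) · Gc(p[e := 1]) = 2 p_e² (1 − p_e) · [ q₁ · (Φ₀₁ + Φ₁₀) + (q₀ − q₁) · Φ₁₁ ]`,

`T₂ = triSum p {e} (τ[e := 2]) K₃`, `q_s = P^s(Q)`,
`Φ_st = P^s(Q, bL) P^t(Q, oH) + P^s(Q, bH) P^t(Q, oL) − P^s(Q, opp) P^t(Q)` (`opp` = `b`, `o` on
opposite sides), `P^s` the law with `p_e := s`. `Φ₁₁ ≥ 0` is BHK06 Thm 1.4 (`bLoH_mul_Q_le`,
`bHoL_mul_Q_le`), `q₀ ≥ q₁` is `Q` decreasing (`prob_Q_update_one_le`), and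

* **`MixedBHK`** (CANDIDATE, a `def`, NOT claimed proved): `Φ₀₁ + Φ₁₀ ≥ 0` — the cross-cluster
  inequality for the exchangeable pair coupling with exactly ONE complementary edge (equivalently:
  the middle Bernstein coefficient of the BHK slack `t ↦ Φ(t, t)`, a quadratic in `p_e`, is `≥ 0`;
  census 0 / 1,800 exact random tests, this seat); it is not an instance of one-measure BHK;

* **`wrow23_of_a3Inactive_of_mixedBHK`**: (W-ROW-23) at every edge of every `a₃`-inactive
  instance ⟸ `MixedBHK` — the weighted twin of g19's typed `row23_of_inactive` (there: the
  decreasing spectator + the typed two-copy `CrossCount`; here: `Q` decreasing + BHK + mixed BHK).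

Own work; standard axioms.
-/

namespace Summit.Ventures.PercRepro2

open UnionCluster

namespace CovForm

/-! ## `a₃` inactive: the row is BHK + mixed BHK -/

section Inactive

open A3Inactive

variable {V : Type*} {E : Type*} [Fintype E] [DecidableEq E] [Fintype V] [DecidableEq V]
  {R : Type*} [Field R] [LinearOrder R] [IsStrictOrderedRing R]

/-- **MIXED BHK, a CANDIDATE (NOT claimed proved)**: the two-copy cross-cluster inequality of
BHK06 Thm 1.4 for the pair `(y ~ P⁰, w ~ P¹) + (y ~ P¹, w ~ P⁰)`, `P^s` the law with `p_e := s` —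
the exchangeable pair coupling with exactly ONE complementary edge; both cross terms (`b` on
`a₁`'s side with `o` on `a₂`'s, and the mirror) summed. Equivalently: the middle Bernstein
coefficient of the BHK slack `t ↦ Φ(t, t)` along `p_e` is nonnegative. Census (this seat, exact
rationals): 0 failures on 1,800 random tests, each cross term separately too. -/
def MixedBHK (ends : E → Sym2 V) (o a₁ a₂ b : V) : Prop :=
  ∀ (p : E → R), IsProbVec p → ∀ e : E,
    prob (Function.update p e 0) (avoidAll ends a₂ {a₁}) *
          prob (Function.update p e 1)
            (avoidAll ends a₂ {a₁} ∩ (connEvent ends a₂ o ∩ connEvent ends a₁ b)) +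
        prob (Function.update p e 1) (avoidAll ends a₂ {a₁}) *
          prob (Function.update p e 0)
            (avoidAll ends a₂ {a₁} ∩ (connEvent ends a₂ o ∩ connEvent ends a₁ b)) +
        prob (Function.update p e 0) (avoidAll ends a₂ {a₁}) *
          prob (Function.update p e 1)
            (avoidAll ends a₂ {a₁} ∩ (connEvent ends a₁ o ∩ connEvent ends a₂ b)) +
        prob (Function.update p e 1) (avoidAll ends a₂ {a₁}) *
          prob (Function.update p e 0)
            (avoidAll ends a₂ {a₁} ∩ (connEvent ends a₁ o ∩ connEvent ends a₂ b)) ≤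
      prob (Function.update p e 0) (avoidAll ends a₂ {a₁} ∩ connEvent ends a₁ b) *
          prob (Function.update p e 1) (avoidAll ends a₂ {a₁} ∩ connEvent ends a₂ o) +
        prob (Function.update p e 1) (avoidAll ends a₂ {a₁} ∩ connEvent ends a₁ b) *
          prob (Function.update p e 0) (avoidAll ends a₂ {a₁} ∩ connEvent ends a₂ o) +
        prob (Function.update p e 0) (avoidAll ends a₂ {a₁} ∩ connEvent ends a₂ b) *
          prob (Function.update p e 1) (avoidAll ends a₂ {a₁} ∩ connEvent ends a₁ o) +
        prob (Function.update p e 1) (avoidAll ends a₂ {a₁} ∩ connEvent ends a₂ b) *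
          prob (Function.update p e 0) (avoidAll ends a₂ {a₁} ∩ connEvent ends a₁ o)

omit [Fintype V] [DecidableEq V] in
/-- `Q = {a₁ ↮ a₂}` is decreasing: opening `e` does not increase its probability. -/
lemma prob_Q_update_one_le (p : E → R) (hp : IsProbVec p) (ends : E → Sym2 V) (a₁ a₂ : V)
    (e : E) :
    prob (Function.update p e 1) (avoidAll ends a₂ {a₁}) ≤
      prob (Function.update p e 0) (avoidAll ends a₂ {a₁}) := by
  rw [prob_eq_expect_indicator, prob_eq_expect_indicator, expect_update_one, expect_update_zero]
  refine expect_mono hp fun ω => ?_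
  by_cases h1 : Function.update ω e true ∈ avoidAll ends a₂ {a₁}
  · have h0 : Function.update ω e false ∈ avoidAll ends a₂ {a₁} := by
      intro x hx hc
      exact h1 x hx (conn_mono (update_false_le_update_true ω e) hc)
    rw [Set.indicator_of_mem h1, Set.indicator_of_mem h0]
    exact le_rfl
  · rw [Set.indicator_of_notMem h1]
    exact Set.indicator_nonneg (fun _ _ => zero_le_one) _

omit [Fintype V] [DecidableEq V] in
/-- **The `a₃`-inactive row identity**: with `q_s = P^s(Q)`, the (W-ROW-23) slack at `e` is
`2 p_e² (1 − p_e) · [ q₁ · M + (q₀ − q₁) · Φ₁₁ ]`, `M` the mixed-BHK slack, `Φ₁₁` the BHK slack of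
the contraction. -/
theorem wrow23_slack_of_a3Inactive (p : E → R) (e : E) (τ : E → ℕ) (hτ : τ e = 2)
    (ends : E → Sym2 V) (o a₁ a₂ a₃ b : V)
    (h : ∀ ω : Config E, ¬ Conn ends ω a₁ a₃ ∧ ¬ Conn ends ω a₂ a₃) :
    triSum p {e} τ (K3 ends o a₁ a₂ a₃ b) -
        p e ^ 2 * (1 - p e) * Gc (Function.update p e 1) ends o a₁ a₂ a₃ b =
      2 * (p e ^ 2 * (1 - p e)) *
        (prob (Function.update p e 1) (avoidAll ends a₂ {a₁}) *
          ((prob (Function.update p e 0) (avoidAll ends a₂ {a₁} ∩ connEvent ends a₁ b) *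
              prob (Function.update p e 1) (avoidAll ends a₂ {a₁} ∩ connEvent ends a₂ o) +
            prob (Function.update p e 1) (avoidAll ends a₂ {a₁} ∩ connEvent ends a₁ b) *
              prob (Function.update p e 0) (avoidAll ends a₂ {a₁} ∩ connEvent ends a₂ o) +
            prob (Function.update p e 0) (avoidAll ends a₂ {a₁} ∩ connEvent ends a₂ b) *
              prob (Function.update p e 1) (avoidAll ends a₂ {a₁} ∩ connEvent ends a₁ o) +
            prob (Function.update p e 1) (avoidAll ends a₂ {a₁} ∩ connEvent ends a₂ b) *
              prob (Function.update p e 0) (avoidAll ends a₂ {a₁} ∩ connEvent ends a₁ o)) -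
           (prob (Function.update p e 0) (avoidAll ends a₂ {a₁}) *
              prob (Function.update p e 1)
                (avoidAll ends a₂ {a₁} ∩ (connEvent ends a₂ o ∩ connEvent ends a₁ b)) +
            prob (Function.update p e 1) (avoidAll ends a₂ {a₁}) *
              prob (Function.update p e 0)
                (avoidAll ends a₂ {a₁} ∩ (connEvent ends a₂ o ∩ connEvent ends a₁ b)) +
            prob (Function.update p e 0) (avoidAll ends a₂ {a₁}) *
              prob (Function.update p e 1)
                (avoidAll ends a₂ {a₁} ∩ (connEvent ends a₁ o ∩ connEvent ends a₂ b)) +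
            prob (Function.update p e 1) (avoidAll ends a₂ {a₁}) *
              prob (Function.update p e 0)
                (avoidAll ends a₂ {a₁} ∩ (connEvent ends a₁ o ∩ connEvent ends a₂ b)))) +
         (prob (Function.update p e 0) (avoidAll ends a₂ {a₁}) -
            prob (Function.update p e 1) (avoidAll ends a₂ {a₁})) *
          ((prob (Function.update p e 1) (avoidAll ends a₂ {a₁} ∩ connEvent ends a₁ b) *
              prob (Function.update p e 1) (avoidAll ends a₂ {a₁} ∩ connEvent ends a₂ o) -
            prob (Function.update p e 1) (avoidAll ends a₂ {a₁}) *
              prob (Function.update p e 1)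
                (avoidAll ends a₂ {a₁} ∩ (connEvent ends a₂ o ∩ connEvent ends a₁ b))) +
           (prob (Function.update p e 1) (avoidAll ends a₂ {a₁} ∩ connEvent ends a₂ b) *
              prob (Function.update p e 1) (avoidAll ends a₂ {a₁} ∩ connEvent ends a₁ o) -
            prob (Function.update p e 1) (avoidAll ends a₂ {a₁}) *
              prob (Function.update p e 1)
                (avoidAll ends a₂ {a₁} ∩ (connEvent ends a₁ o ∩ connEvent ends a₂ b))))) := by
  rw [triSum_singleton_two_K3 p e τ hτ ends o a₁ a₂ a₃ b,
    Gc_eq_of_a3Inactive (Function.update p e 1) ends o a₁ a₂ a₃ b h]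
  unfold mix3 EQbo EQb3 EQb3o EQo EQ3 EQ3o PDb PDbo Do
  rw [gap_eq_Q, gap_eq_Q]
  simp only [TEvent_eq_empty h, TEvent'_eq_empty h, PDEvent_eq_Q h, Set.empty_inter, prob_empty]
  ring

/-- **(W-ROW-23) on `a₃`-inactive instances from mixed BHK**: at every edge `e` of every instance
with an inactive `a₃`, `p_e² (1 − p_e) · Gc(p[e := 1]) ≤ T₂(p)` — from `Q` decreasing, BHK06 Thm 1.4
for the contraction, and the mixed-BHK candidate. -/
theorem wrow23_of_a3Inactive_of_mixedBHK (ends : E → Sym2 V) (o a₁ a₂ a₃ b : V)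
    (hm : MixedBHK (R := R) ends o a₁ a₂ b)
    (h : ∀ ω : Config E, ¬ Conn ends ω a₁ a₃ ∧ ¬ Conn ends ω a₂ a₃)
    (p : E → R) (hp : IsProbVec p) (e : E) (τ : E → ℕ) (hτ : τ e = 2) :
    p e ^ 2 * (1 - p e) * Gc (Function.update p e 1) ends o a₁ a₂ a₃ b ≤
      triSum p {e} τ (K3 ends o a₁ a₂ a₃ b) := by
  have hid := wrow23_slack_of_a3Inactive p e τ hτ ends o a₁ a₂ a₃ b h
  have hM : 0 ≤ (prob (Function.update p e 0) (avoidAll ends a₂ {a₁} ∩ connEvent ends a₁ b) *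
          prob (Function.update p e 1) (avoidAll ends a₂ {a₁} ∩ connEvent ends a₂ o) +
        prob (Function.update p e 1) (avoidAll ends a₂ {a₁} ∩ connEvent ends a₁ b) *
          prob (Function.update p e 0) (avoidAll ends a₂ {a₁} ∩ connEvent ends a₂ o) +
        prob (Function.update p e 0) (avoidAll ends a₂ {a₁} ∩ connEvent ends a₂ b) *
          prob (Function.update p e 1) (avoidAll ends a₂ {a₁} ∩ connEvent ends a₁ o) +
        prob (Function.update p e 1) (avoidAll ends a₂ {a₁} ∩ connEvent ends a₂ b) *
          prob (Function.update p e 0) (avoidAll ends a₂ {a₁} ∩ connEvent ends a₁ o)) -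
       (prob (Function.update p e 0) (avoidAll ends a₂ {a₁}) *
          prob (Function.update p e 1)
            (avoidAll ends a₂ {a₁} ∩ (connEvent ends a₂ o ∩ connEvent ends a₁ b)) +
        prob (Function.update p e 1) (avoidAll ends a₂ {a₁}) *
          prob (Function.update p e 0)
            (avoidAll ends a₂ {a₁} ∩ (connEvent ends a₂ o ∩ connEvent ends a₁ b)) +
        prob (Function.update p e 0) (avoidAll ends a₂ {a₁}) *
          prob (Function.update p e 1)
            (avoidAll ends a₂ {a₁} ∩ (connEvent ends a₁ o ∩ connEvent ends a₂ b)) +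
        prob (Function.update p e 1) (avoidAll ends a₂ {a₁}) *
          prob (Function.update p e 0)
            (avoidAll ends a₂ {a₁} ∩ (connEvent ends a₁ o ∩ connEvent ends a₂ b))) :=
    sub_nonneg.mpr (hm p hp e)
  have hq := prob_Q_update_one_le p hp ends a₁ a₂ e
  have hp1 : IsProbVec (Function.update p e 1) := hp.update e zero_le_one le_rfl
  have hΦ1 := bLoH_mul_Q_le (Function.update p e 1) hp1 ends o a₁ a₂ b
  have hΦ2 := bHoL_mul_Q_le (Function.update p e 1) hp1 ends o a₁ a₂ b
  have hΦ : 0 ≤ (prob (Function.update p e 1) (avoidAll ends a₂ {a₁} ∩ connEvent ends a₁ b) *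
          prob (Function.update p e 1) (avoidAll ends a₂ {a₁} ∩ connEvent ends a₂ o) -
        prob (Function.update p e 1) (avoidAll ends a₂ {a₁}) *
          prob (Function.update p e 1)
            (avoidAll ends a₂ {a₁} ∩ (connEvent ends a₂ o ∩ connEvent ends a₁ b))) +
       (prob (Function.update p e 1) (avoidAll ends a₂ {a₁} ∩ connEvent ends a₂ b) *
          prob (Function.update p e 1) (avoidAll ends a₂ {a₁} ∩ connEvent ends a₁ o) -
        prob (Function.update p e 1) (avoidAll ends a₂ {a₁}) *
          prob (Function.update p e 1)
            (avoidAll ends a₂ {a₁} ∩ (connEvent ends a₁ o ∩ connEvent ends a₂ b))) := by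
    linarith
  have hQ1 := prob_nonneg hp1 (avoidAll ends a₂ {a₁})
  have hc : 0 ≤ 2 * (p e ^ 2 * (1 - p e)) :=
    mul_nonneg (by norm_num) (mul_nonneg (pow_nonneg (hp.nonneg e) 2)
      (sub_nonneg.mpr (hp.le_one e)))
  rw [← sub_nonneg, hid]
  exact mul_nonneg hc (add_nonneg (mul_nonneg hQ1 hM) (mul_nonneg (sub_nonneg.mpr hq) hΦ))

end Inactive

end CovForm

end Summit.Ventures.PercRepro2
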